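import Literature.AlgebraicGeometry.Hyperkaehler.K3HilbertType
import Literature.AlgebraicGeometry.Surfaces.K3LatticePolarizationClasses
import Literature.AlgebraicGeometry.Surfaces.K3LatticeOrthogonalNegTwoVectorOrbits
import Literature.Topology.FourManifolds.LatticeFormsDivisorOneStabiliserQuotientOrbit
import Literature.Topology.FourManifolds.LatticeFormsPolarisationTypesGeneralDivisor
import Literature.Topology.FourManifolds.LatticeFormsStableOrthogonalGroupSmallDiscriminant
import HarnessLib

/-!
# The `K3^{[n]}` lattice `Λ_n = Λ_{K3} ⊕ ⟨2 − 2n⟩` as an integral lattice: the model `2E₈(−1) ⊕ 3U ⊕ ⟨−2(n−1)⟩`,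
# invariants `(3, 20)`, `|D(Λ_n)| = 2(n−1)`, and the polarisation types of Gritsenko–Hulek–Sankaran
# (*Compositio Math.* 146 (2010) §4: Examples 4.8, 4.10, 4.11, Prop. 4.12 (ii) for `f = 1`)

Layer `Literature/AlgebraicGeometry/Hyperkaehler`. Written for lane `lit-hodgefound` (Track 2 foundations; prover seat
`lit-hodgefound-p18`, gen 43, row g43-#1). THEOREMS ONLY — no definition, no named fact, no instance, no notation.

The tree's `K3^{[n]}` lattice OF RECORD is the Gram matrix `Hyperkaehler.k3HilbertGram n = fromBlocks k3Gram 0 0 (2 − 2n)` on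
`K3HilbertIndex = K3Index ⊕ Unit` (`K3HilbertType.lean`: the marking target `Λ_{K3} ⊕ ℤδ`, `(δ, δ) = 2 − 2n`, of
`H²(X, ℤ)` with its Beauville–Bogomolov form for `X` of `K3^{[n]}`-type, Beauville 1983 §9, Markman §1.3). This file reads
the integral bilinear form `Matrix.toBilin' (k3HilbertGram n)` through the lattice files
`Literature/Topology/FourManifolds/LatticeForms*.lean`, where GHS's `L_{2t} = L_{K3} ⊕ ⟨−2t⟩ = 3U ⊕ 2E₈(−1) ⊕ ⟨−2t⟩`
is the coordinate model `((pi fun _ : Fin 2 ↦ -e8Form).prod (hyperbolicSum 3)).prod ((-(2t)) • LinearMap.mul ℤ ℤ)` and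
the abstract results are stated for `B₀ ⊕ ⟨−2t⟩`, `B₀` even unimodular with two orthogonal hyperbolic planes. Here
`t = n − 1`.

## Sources, verbatim

* V. Gritsenko, K. Hulek, G. K. Sankaran, *Moduli spaces of irreducible symplectic manifolds*, Compositio Math. 146
  (2010) 404–434 (held text `paper:arxiv-0802.2078`, arXiv numbering). §1 (p. 2): "It is well known that
  `(H²(S^{[n]}, ℤ), q_X) = 3U ⊕ 2E₈(−1) ⊕ ⟨−2(n−1)⟩`". §4 (p. 10): "We consider the special lattice
  `L_{2t} = 3U ⊕ 2E₈(−1) ⊕ ⟨−2t⟩` […] It has signature `(3, 20)`. […] Note that `div(h_d)` is a common divisor of `2d`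
  and `2t = −det(L_{2t})`." Example 4.8 (p. 12): "Let `f = 1`. […] for any `t` and `d` there is only one
  `Õ(L_{2t})`-orbit of primitive vectors `h_d` with `div(h_d) = 1`. Moreover `(h_d)^⊥_{L_{2t}} ≅ L_{2t,2d} = 2U ⊕
  2E₈(−1) ⊕ ⟨−2t⟩ ⊕ ⟨−2d⟩`." Definition 4.9: "split type if `div(h) = 1`". Example 4.10: "`f = 2`. […] A constant
  `b` and a vector `h_d` exist if and only if `d + t ≡ 0 mod 4`. Moreover the `Õ(L_{2t})`-orbit of `h_d` is unique
  […] `(h_d)^⊥_{L_{2t}} ≅ 2U ⊕ 2E₈(−1) ⊕ (−2b t ∕ t −2t)` where `4b = d + t`." Example 4.11: "if `(t, d) = 1`, then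
  `f = div(h_d)` is equal to `1` or `2`". Prop. 4.12 (ii): "The factor group `O(L_{2t}, h_d)/Õ(L_{2t}, h_d)` is an
  abelian `2`-group, which is of order `2^{ρ(t/f)}` if `f` is odd."
* V. Gritsenko, K. Hulek, G. K. Sankaran, *The Hirzebruch–Mumford volume for the orthogonal group and applications*,
  Doc. Math. 12 (2007): §4 Lemma 4.3 (`|O(q_{⟨−2t⟩})| = 2^{ρ(t)}`).
* A. Beauville, J. Differential Geom. 18 (1983) §9 Lemme 1, Remarque 1; E. Markman, Compositio 160 (2024) §1.3
  (`Λ = L ⊕ ℤδ`, `(δ, δ) = 2 − 2n`) — the definition of `k3HilbertGram` (`K3HilbertType.lean`).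

## Contents (all proved; `Λ_n := Matrix.toBilin' (k3HilbertGram n)`, `t = n − 1`)

* §1 **The model.** `toBilin'_k3HilbertGram_apply` (`Λ_n(v, w) = Λ_{K3}(v|, w|) + (2 − 2n) v_δ w_δ`); the explicit
  isometry `Λ_n ⥲ Λ_{K3} ⊕ ⟨−2(n−1)⟩`, `v ↦ (v|_{K3Index}, v_δ)` (`exists_isometryEquiv_toBilin'_k3HilbertGram_prod`) and
  `Λ_n ≅ (E₈(−1)^{⊕2} ⊕ U^{⊕3}) ⊕ ⟨−2(n−1)⟩` (`toBilin'_k3HilbertGram_equivalent_model`), `n ≥ 1`.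
* §2 **Invariants.** Symmetric, even (all `n`); rank `23`; for `n ≥ 2`: nondegenerate, not unimodular, signature
  `(3, 20)`, `|D(Λ_n)| = 2(n − 1)`; two orthogonal hyperbolic planes in `Λ_{K3}`.
* §3 **Polarisation types (GHS 2010 §4) in `Λ_n`, `n ≥ 2`.** `div(h) ∣ 2(n−1)` for primitive `h`
  (`k3Hilbert_dvd_two_mul_of_forall_dvd_of_primitive`); Example 4.11 (`gcd(n−1, d) = 1 ⟹` split or `div = 2`);
  Example 4.8 (split vectors of equal square lie in one `Õ(Λ_n)`-orbit; exactly one orbit in each degree; the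
  complement `h^⊥ ≅ (2E₈(−1) ⊕ 2U ⊕ ⟨−2d⟩) ⊕ ⟨−2(n−1)⟩`); Example 4.10 (non-split vectors with `div = 2`: `h_δ` odd and
  `4 ∣ d + (n−1)`; one `Õ(Λ_n)`-orbit; `#orbits = if 4 ∣ d + (n−1) then 1 else 0`; complement
  `≅ (2E₈(−1) ⊕ 2U) ⊕ (−2b t ∕ t −2t)`); `|O(q_{Λ_n})| = 2^{ρ(n−1)}`; Prop. 4.12 (ii), `f = 1`: for every split `h` with
  `h² ≠ 0`, `#(O(Λ_n, h)|_{h^⊥} ∕ Õ) = 2^{ρ(n−1)}`.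

* §4 **Prop. 4.6 for a general divisor `f` in `Λ_n`** (appended, row g43-#4; from
  `LatticeFormsPolarisationTypesGeneralDivisor.lean`): `gcd(f, h_δ) = 1` for primitive `h` with `f ∣ (h, Λ_n)`,
  `f² ∣ d + (n−1)h_δ²`, the number of `Õ(Λ_n)`-orbits of primitive `h` with `h² = 2d`, `(h, Λ_n) = fℤ` equals
  `#{c mod f : (c, f) = 1, f² ∣ d + (n−1)c²}` (`f ∣ 2(n−1)`), and (iv) `h^⊥ ≅ (2E₈(−1) ⊕ 2U) ⊕ (−2b a ∕ a −2(n−1))`,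
  `f²b = d + (n−1)h_δ²`, `fa = 2(n−1)h_δ`.
* §5 **`K3^{[2]}` (`n = 2`, `t = 1`)** (appended, row g43-#4): every primitive `h ∈ Λ_2` of square `2d` is split or
  non-split with `(h, Λ_2) = 2ℤ`, the latter only for `d ≡ −1 (mod 4)` (Examples 4.10/4.11 with `(1, d) = 1`); since
  `Õ(Λ_2) = O(Λ_2)`, the `O(Λ_2)`-orbits of split resp. non-split vectors of square `2d` number `1` resp.
  `if 4 ∣ d + 1 then 1 else 0`; complements `(2E₈(−1) ⊕ 2U ⊕ ⟨−2d⟩) ⊕ ⟨−2⟩` and `(2E₈(−1) ⊕ 2U) ⊕ (−2b 1 ∕ 1 −2)`,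
  `4b = d + 1`.

Not here: the closed-form evaluation Prop. 4.6 (i)–(iii); the geometric identification `H²(X, ℤ) ≅ Λ_n` (a named
fact elsewhere, `K3HilbertSchemeBeauvilleFujiki.lean`); monodromy (`K3HilbertTypeMonodromy.lean`).

## References

* [GritsenkoHulekSankaran2010Symplectic] V. Gritsenko, K. Hulek, G. K. Sankaran, Moduli spaces of irreducible
  symplectic manifolds, Compositio Math. 146 (2010) 404–434: §1, §4 Prop. 4.6, Examples 4.8, 4.10, 4.11, Def. 4.9,
  Prop. 4.12 (ii), §5 (display after "where `t = 1`").
* [GritsenkoHulekSankaran2007HM] V. Gritsenko, K. Hulek, G. K. Sankaran, The Hirzebruch–Mumford volume for the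
  orthogonal group and applications, Doc. Math. 12 (2007): §4 Lemma 4.3.
* [Beauville1983] A. Beauville, Variétés kählériennes dont la première classe de Chern est nulle, J. Differential
  Geom. 18 (1983): §9 Lemme 1, Remarque 1.
* [Markman2024] E. Markman, Rational Hodge isometries of hyper-Kähler varieties of `K3^{[n]}` type are algebraic,
  Compositio Math. 160 (2024): §1.3 Step 1.
* [Huybrechts2016K3] D. Huybrechts, Lectures on K3 Surfaces, CUP 2016: Ch. 14 §0.3 (vi), Cor. 1.3 (i).
-/

noncomputable section

open Module Function
open LinearMap (BilinForm)
open LinearMap.BilinForm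
open Literature.Topology.FourManifolds
open Literature.AlgebraicGeometry.Surfaces

namespace Literature.AlgebraicGeometry.Hyperkaehler

/-! ### §1 The model `Λ_n ≅ Λ_{K3} ⊕ ⟨−2(n−1)⟩ ≅ 2E₈(−1) ⊕ 3U ⊕ ⟨−2(n−1)⟩` -/

/-- Evaluation of the `K3^{[n]}` form: `Λ_n(v, w) = Λ_{K3}(v|, w|) + (2 − 2n) · v_δ w_δ` (block-diagonal Gram matrix).
[cite: Beauville1983, §9 Lemme 1 and Remarque 1] [cite: Markman2024, §1.3 Step 1] -/
theorem toBilin'_k3HilbertGram_apply (n : ℕ) (v w : K3HilbertIndex → ℤ) :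
    Matrix.toBilin' (k3HilbertGram n) v w =
      Matrix.toBilin' k3Gram (fun i ↦ v (Sum.inl i)) (fun i ↦ w (Sum.inl i)) +
        (2 - 2 * (n : ℤ)) * (v (Sum.inr ()) * w (Sum.inr ())) := by
  simp only [Matrix.toBilin'_apply, Fintype.sum_sum_type, k3HilbertGram, Matrix.fromBlocks_apply₁₁,
    Matrix.fromBlocks_apply₁₂, Matrix.fromBlocks_apply₂₁, Matrix.fromBlocks_apply₂₂, Matrix.zero_apply, mul_zero,
    zero_mul, Finset.sum_const_zero, add_zero, zero_add, Matrix.of_apply, Fintype.sum_unique, PUnit.default_eq_unit]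
  ring

/-- **`Λ_n ⥲ Λ_{K3} ⊕ ⟨−2(n−1)⟩`, `v ↦ (v|_{Λ_{K3}}, v_δ)`** (`n ≥ 1`): the `K3^{[n]}` lattice of record is the orthogonal
sum of the K3 lattice and `⟨2 − 2n⟩ = ⟨−2(n−1)⟩` ("`(H²(S^{[n]}, ℤ), q_X) = 3U ⊕ 2E₈(−1) ⊕ ⟨−2(n−1)⟩`", i.e.
`L_{K3} ⊕ ⟨−2t⟩` with `t = n − 1`). [cite: GritsenkoHulekSankaran2010Symplectic, §1 (display (1))] [cite: Markman2024, §1.3 Step 1] -/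
theorem exists_isometryEquiv_toBilin'_k3HilbertGram_prod {n : ℕ} (hn : 1 ≤ n) :
    ∃ ψ : (Matrix.toBilin' (k3HilbertGram n)).IsometryEquiv
        ((Matrix.toBilin' k3Gram).prod ((-(2 * (n - 1 : ℕ) : ℤ)) • LinearMap.mul ℤ ℤ)),
      ∀ v, ψ v = (fun i ↦ v (Sum.inl i), v (Sum.inr ())) := by
  have hc : (2 - 2 * (n : ℤ)) = -(2 * (n - 1 : ℕ) : ℤ) := by push_cast [Nat.cast_sub hn]; ring
  let L : (K3HilbertIndex → ℤ) ≃ₗ[ℤ] (K3Index → ℤ) × ℤ :=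
    (LinearEquiv.sumArrowLequivProdArrow K3Index Unit ℤ ℤ).trans
      ((LinearEquiv.refl ℤ _).prodCongr (LinearEquiv.funUnique Unit ℤ ℤ))
  have hL : ∀ v, L v = (fun i ↦ v (Sum.inl i), v (Sum.inr ())) := fun v ↦ rfl
  refine ⟨{ L with map_app' := fun v w ↦ ?_ }, hL⟩
  change (Matrix.toBilin' k3Gram).prod ((-(2 * (n - 1 : ℕ) : ℤ)) • LinearMap.mul ℤ ℤ) (L v) (L w) =
    Matrix.toBilin' (k3HilbertGram n) v w
  rw [hL, hL, prod_neg_twoMul_smul_mul_apply, toBilin'_k3HilbertGram_apply, hc]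
  ring

/-- **`Λ_n ≅ (E₈(−1)^{⊕2} ⊕ U^{⊕3}) ⊕ ⟨−2(n−1)⟩ = L_{2(n−1)}`** (`n ≥ 1`): the `K3^{[n]}` lattice of record is isometric to
GHS's `L_{2t} = 3U ⊕ 2E₈(−1) ⊕ ⟨−2t⟩`, `t = n − 1`, in the coordinate model of the lattice files (via
`Λ_{K3} ≅ E₈(−1)^{⊕2} ⊕ U^{⊕3}`, Huybrechts Ch. 14 Cor. 1.3 (i)). [cite: GritsenkoHulekSankaran2010Symplectic, §1 (display (1)) and §4 (display (defineL2t): "`L_{2t} = 3U ⊕ 2E₈(−1) ⊕ ⟨−2t⟩`")] [cite: Huybrechts2016K3, Ch. 14 §0.3 (vi) and Cor. 1.3 (i)] -/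
theorem toBilin'_k3HilbertGram_equivalent_model {n : ℕ} (hn : 1 ≤ n) :
    (Matrix.toBilin' (k3HilbertGram n)).Equivalent
      (((LinearMap.BilinForm.pi fun _ : Fin 2 ↦ -e8Form).prod (hyperbolicSum 3)).prod
        ((-(2 * (n - 1 : ℕ) : ℤ)) • LinearMap.mul ℤ ℤ)) := by
  obtain ⟨ψ, -⟩ := exists_isometryEquiv_toBilin'_k3HilbertGram_prod hn
  exact LinearMap.BilinForm.Equivalent.trans ⟨ψ⟩
    (toBilin'_k3Gram_equivalent_pi_neg_e8Form_prod_hyperbolicSum.prod (Equivalent.refl _))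

/-! ### §2 Invariants: even, rank `23`, signature `(3, 20)`, `|D(Λ_n)| = 2(n−1)` -/

/-- `Λ_n` is symmetric. [cite: GritsenkoHulekSankaran2010Symplectic, §4 ("Let `L` be an even lattice")] -/
theorem isSymm_toBilin'_k3HilbertGram (n : ℕ) : (Matrix.toBilin' (k3HilbertGram n)).IsSymm :=
  Matrix.isSymm_toBilin'_iff_isSymm.mpr (k3HilbertGram_transpose n)

/-- `Λ_n` is even. [cite: GritsenkoHulekSankaran2010Symplectic, §4 ("Let `L` be an even lattice"; `L_{2t}` is even)] -/
theorem isEven_toBilin'_k3HilbertGram (n : ℕ) : (Matrix.toBilin' (k3HilbertGram n)).IsEven := fun v ↦ by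
  obtain ⟨a, ha⟩ := isEven_toBilin'_k3Gram (fun i ↦ v (Sum.inl i))
  rw [toBilin'_k3HilbertGram_apply, ha]
  exact ⟨a + (1 - n) * (v (Sum.inr ()) * v (Sum.inr ())), by ring⟩

/-- `rk Λ_n = 23`. [cite: GritsenkoHulekSankaran2010Symplectic, §1 ("`H²(X, ℤ)` … of signature `(3, 20)`")] -/
theorem finrank_k3HilbertIndex_fun : finrank ℤ (K3HilbertIndex → ℤ) = 23 := by
  rw [Module.finrank_fintype_fun_eq_card, card_k3HilbertIndex]

/-- `Λ_n` is nondegenerate for `n ≥ 2` ("By lattice … we always mean a non-degenerate lattice"; `det Λ_n = 2n − 2 ≠ 0`).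
[cite: GritsenkoHulekSankaran2010Symplectic, §4 (first paragraph)] -/
theorem nondegenerate_toBilin'_k3HilbertGram {n : ℕ} (hn : 2 ≤ n) : (Matrix.toBilin' (k3HilbertGram n)).Nondegenerate := by
  obtain ⟨ψ, -⟩ := exists_isometryEquiv_toBilin'_k3HilbertGram_prod (n := n) (by omega)
  exact ψ.symm.nondegenerate (nondegenerate_prod_neg_twoMul_smul_mul _ (n - 1) isUnimodular_toBilin'_k3Gram (by omega))

/-- **`|D(Λ_n)| = 2(n − 1)`** ("`2t = −det(L_{2t})`"; `n ≥ 1`). [cite: GritsenkoHulekSankaran2010Symplectic, §4 ("`div(h_d)` is a common divisor of `2d` and `2t = −det(L_{2t})`")] -/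
theorem natCard_discriminantGroup_toBilin'_k3HilbertGram {n : ℕ} (hn : 1 ≤ n) :
    Nat.card (Matrix.toBilin' (k3HilbertGram n)).discriminantGroup = 2 * (n - 1) := by
  obtain ⟨ψ, -⟩ := exists_isometryEquiv_toBilin'_k3HilbertGram_prod hn
  rw [Nat.card_congr ψ.discriminantGroupCongr.toEquiv]
  exact natCard_discriminantGroup_prod_neg_twoMul_smul_mul _ (n - 1) isUnimodular_toBilin'_k3Gram

/-- `Λ_n` is not unimodular for `n ≥ 2` (`|D(Λ_n)| = 2(n−1) ≥ 2`). [cite: GritsenkoHulekSankaran2010Symplectic, §4 ("`2t = −det(L_{2t})`")] -/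
theorem not_isUnimodular_toBilin'_k3HilbertGram {n : ℕ} (hn : 2 ≤ n) : ¬ (Matrix.toBilin' (k3HilbertGram n)).IsUnimodular := by
  intro hu
  have h1 := (isUnimodular_iff_natCard_discriminantGroup_eq_one _ (nondegenerate_toBilin'_k3HilbertGram hn)).1 hu
  rw [natCard_discriminantGroup_toBilin'_k3HilbertGram (by omega)] at h1
  omega

/-- **`Λ_n` has signature `(3, 20)`** for `n ≥ 2` ("`L_{2t}` … has signature `(3, 20)`": `(3, 19) + (0, 1)`).
[cite: GritsenkoHulekSankaran2010Symplectic, §4 (after Lemma 4.5)] -/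
theorem sigPos_sigNeg_toBilin'_k3HilbertGram {n : ℕ} (hn : 2 ≤ n) :
    sigPos (Matrix.toBilin' (k3HilbertGram n)).toQuadraticMap = 3 ∧
      sigNeg (Matrix.toBilin' (k3HilbertGram n)).toQuadraticMap = 20 := by
  obtain ⟨ψ, -⟩ := exists_isometryEquiv_toBilin'_k3HilbertGram_prod (n := n) (by omega)
  have hq : (Matrix.toBilin' (k3HilbertGram n)).toQuadraticMap.Equivalent
      ((Matrix.toBilin' k3Gram).prod ((-(2 * (n - 1 : ℕ) : ℤ)) • LinearMap.mul ℤ ℤ)).toQuadraticMap :=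
    ⟨{ ψ.toLinearEquiv with map_app' := fun x ↦ ψ.map_app x x }⟩
  obtain ⟨hp', hn'⟩ := sigPos_sigNeg_neg_two_mul_smul_mul (d := ((n - 1 : ℕ) : ℤ)) (by omega)
  rw [hq.sigPos_eq, hq.sigNeg_eq, sigPos_prod _ _ isSymm_toBilin'_k3Gram (isSymm_smul_mul _),
    sigNeg_prod _ _ isSymm_toBilin'_k3Gram (isSymm_smul_mul _), sigPos_toBilin'_k3Gram, sigNeg_toBilin'_k3Gram, hp', hn']
  omega

/-- **The index: `τ(Λ_n) = −17`** for `n ≥ 2`. [cite: GritsenkoHulekSankaran2010Symplectic, §4 ("signature `(3, 20)`")] -/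
theorem signature_toBilin'_k3HilbertGram {n : ℕ} (hn : 2 ≤ n) : (Matrix.toBilin' (k3HilbertGram n)).signature = -17 := by
  obtain ⟨hp, hq⟩ := sigPos_sigNeg_toBilin'_k3HilbertGram hn
  change (sigPos _ : ℤ) - sigNeg _ = -17
  rw [hp, hq]
  norm_num

/-- The two orthogonal hyperbolic planes `U₂ ⊕ U₃ ⊂ Λ_{K3} = 2E₈(−1) ⊕ 3U` (Eichler's criterion, GHS Lemma 4.5, applies
to `Λ_{K3} ⊕ ⟨−2t⟩`). [cite: GritsenkoHulekSankaran2010Symplectic, §4 Lemma 4.5 ("Let `L` be a lattice containing two orthogonal isotropic planes")] [cite: Huybrechts2016K3, Ch. 14 §0.3 (vi)] -/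
theorem exists_twoHyperbolicPairs_toBilin'_k3Gram :
    ∃ x y x₁ y₁ : K3Index → ℤ, TwoHyperbolicPairs (Matrix.toBilin' k3Gram) x y x₁ y₁ := by
  obtain ⟨e⟩ := toBilin'_k3Gram_equivalent_pi_neg_e8Form_prod_hyperbolicSum
  exact ⟨_, _, _, _, TwoHyperbolicPairs.of_isometryEquiv isSymm_toBilin'_k3Gram e
    (TwoHyperbolicPairs.inr (IsSymm.pi fun _ ↦ isSymm_e8Form.neg)
      (twoHyperbolicPairs_hyperbolicSum (show (1 : Fin 3) ≠ 0 by decide)))⟩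

/-- **`K3^{[2]}`: `Õ(Λ_2) = O(Λ_2)`** — every isometry of `Λ_2 = Λ_{K3} ⊕ ⟨−2⟩` acts trivially on `D(Λ_2) ≅ ℤ/2`
(GHS §5: "where `t = 1`, we have `Õ(L_{2,2d}) = Õ(L_2, h_d) = O(L_2, h_d)`"). [cite: GritsenkoHulekSankaran2010Symplectic, §5 (display after "where `t = 1`")] -/
theorem discriminantGroupCongr_eq_self_toBilin'_k3HilbertGram_two
    (g : (Matrix.toBilin' (k3HilbertGram 2)).IsometryEquiv (Matrix.toBilin' (k3HilbertGram 2)))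
    (a : (Matrix.toBilin' (k3HilbertGram 2)).discriminantGroup) : g.discriminantGroupCongr a = a :=
  discriminantGroupCongr_eq_self_of_natCard_le_two _ (nondegenerate_toBilin'_k3HilbertGram le_rfl)
    (by rw [natCard_discriminantGroup_toBilin'_k3HilbertGram (n := 2) (by norm_num)]) g a

/-! ### §3 Polarisation types in `Λ_n` (GHS 2010 §4), `n ≥ 2`, `t = n − 1` -/

section PolarisationTypes

variable {n : ℕ}

/-- **"`div(h_d)` is a common divisor of `2d` and `2t = −det(L_{2t})`"** in `Λ_n`: if `h ∈ Λ_n` is primitive and `δ`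
divides every product `(h, z)`, then `δ ∣ 2(n − 1)`. [cite: GritsenkoHulekSankaran2010Symplectic, §4 (before Prop. 4.6)] -/
theorem k3Hilbert_dvd_two_mul_of_forall_dvd_of_primitive (hn : 2 ≤ n) {h : K3HilbertIndex → ℤ} {δ : ℤ} (hh0 : h ≠ 0)
    (hsat : ∀ (k : ℤ) (w : K3HilbertIndex → ℤ), k ≠ 0 → k • w ∈ ℤ ∙ h → w ∈ ℤ ∙ h)
    (hδ : ∀ z, δ ∣ Matrix.toBilin' (k3HilbertGram n) h z) : δ ∣ 2 * (n - 1 : ℕ) := by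
  obtain ⟨ψ, -⟩ := exists_isometryEquiv_toBilin'_k3HilbertGram_prod (n := n) (by omega)
  have h0 : ψ h ≠ 0 := fun h1 ↦ hh0 (ψ.toLinearEquiv.map_eq_zero_iff.1 h1)
  exact dvd_two_mul_of_forall_dvd_of_primitive (n - 1) isUnimodular_toBilin'_k3Gram h0
    (forall_mem_span_singleton_apply_of_isometryEquiv ψ hsat) ((forall_dvd_apply_iff_of_isometryEquiv ψ h δ).2 hδ)

/-- **Example 4.11 in `Λ_n`: "if `(t, d) = 1`, then `f = div(h_d)` is equal to `1` or `2`"** — a primitive `h ∈ Λ_n` with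
`h² = 2d`, `gcd(n − 1, d) = 1`, is split (`(h, h') = 1` for some `h'`) or has `(h, Λ_n) = 2ℤ`.
[cite: GritsenkoHulekSankaran2010Symplectic, §4 Example 4.11] -/
theorem k3Hilbert_exists_apply_eq_one_or_forall_two_dvd_of_gcd_eq_one (hn : 2 ≤ n) {h : K3HilbertIndex → ℤ} {d : ℤ}
    (hh : Matrix.toBilin' (k3HilbertGram n) h h = 2 * d) (hh0 : h ≠ 0)
    (hsat : ∀ (k : ℤ) (w : K3HilbertIndex → ℤ), k ≠ 0 → k • w ∈ ℤ ∙ h → w ∈ ℤ ∙ h)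
    (htd : Int.gcd ((n - 1 : ℕ) : ℤ) d = 1) :
    (∃ h', Matrix.toBilin' (k3HilbertGram n) h h' = 1) ∨
      ((∀ z, (2 : ℤ) ∣ Matrix.toBilin' (k3HilbertGram n) h z) ∧ ∃ h', Matrix.toBilin' (k3HilbertGram n) h h' = 2) := by
  obtain ⟨ψ, -⟩ := exists_isometryEquiv_toBilin'_k3HilbertGram_prod (n := n) (by omega)
  have h0 : ψ h ≠ 0 := fun h1 ↦ hh0 (ψ.toLinearEquiv.map_eq_zero_iff.1 h1)
  have h1 := exists_apply_eq_one_or_forall_two_dvd_of_isCoprime (n - 1) isUnimodular_toBilin'_k3Gram (r := ψ h) (d := d)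
    (by rw [ψ.map_app, hh]) h0 (forall_mem_span_singleton_apply_of_isometryEquiv ψ hsat) htd
  rwa [exists_apply_eq_iff_of_isometryEquiv ψ h 1, exists_apply_eq_iff_of_isometryEquiv ψ h 2,
    forall_dvd_apply_iff_of_isometryEquiv ψ h 2] at h1

/-- **Example 4.8 in `Λ_n`, the orbit: split vectors of the same square lie in ONE `Õ(Λ_n)`-orbit** ("for any `t` and `d`
there is only one `Õ(L_{2t})`-orbit of primitive vectors `h_d` with `div(h_d) = 1`"; Eichler's criterion, the K3 lattice
containing two orthogonal hyperbolic planes). [cite: GritsenkoHulekSankaran2010Symplectic, §4 Example 4.8] -/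
theorem k3Hilbert_exists_stable_isometryEquiv_apply_eq_of_apply_eq_one (hn : 2 ≤ n) {u v u' v' : K3HilbertIndex → ℤ}
    (huv : Matrix.toBilin' (k3HilbertGram n) u u = Matrix.toBilin' (k3HilbertGram n) v v)
    (hu' : Matrix.toBilin' (k3HilbertGram n) u u' = 1) (hv' : Matrix.toBilin' (k3HilbertGram n) v v' = 1) :
    ∃ g : (Matrix.toBilin' (k3HilbertGram n)).IsometryEquiv (Matrix.toBilin' (k3HilbertGram n)),
      g.discriminantGroupCongr = LinearEquiv.refl ℤ _ ∧ g u = v := by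
  obtain ⟨ψ, -⟩ := exists_isometryEquiv_toBilin'_k3HilbertGram_prod (n := n) (by omega)
  obtain ⟨x, y, x₁, y₁, hP⟩ := exists_twoHyperbolicPairs_toBilin'_k3Gram
  obtain ⟨g₀, hg₀, hg₀u⟩ := exists_stable_isometryEquiv_apply_eq_of_apply_eq_one_of_apply_eq_one (n - 1)
    isUnimodular_toBilin'_k3Gram isEven_toBilin'_k3Gram (by omega) hP (u := ψ u) (v := ψ v) (u' := ψ u') (v' := ψ v')
    (by rw [ψ.map_app, ψ.map_app, huv]) (by rw [ψ.map_app, hu']) (by rw [ψ.map_app, hv'])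
  refine ⟨ψ.trans (g₀.trans ψ.symm), discriminantGroupCongr_trans_trans_symm_eq_refl ψ hg₀, ?_⟩
  rw [LinearMap.BilinForm.IsometryEquiv.trans_apply, LinearMap.BilinForm.IsometryEquiv.trans_apply, hg₀u]
  exact ψ.toLinearEquiv.symm_apply_apply v

/-- **Example 4.8 in `Λ_n` as a count: the split vectors of square `2d` form exactly one `Õ(Λ_n)`-orbit** (every
`d ∈ ℤ`, `n ≥ 2`; Definition 4.9: "split type if `div(h) = 1`"). [cite: GritsenkoHulekSankaran2010Symplectic, §4 Example 4.8, Definition 4.9] -/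
theorem k3Hilbert_natCard_quot_stable_isometryEquiv_of_apply_eq_one (hn : 2 ≤ n) (d : ℤ) :
    Nat.card (Quot fun r s : {r : K3HilbertIndex → ℤ // Matrix.toBilin' (k3HilbertGram n) r r = 2 * d ∧
        ∃ r', Matrix.toBilin' (k3HilbertGram n) r r' = 1} ↦
      ∃ g : (Matrix.toBilin' (k3HilbertGram n)).IsometryEquiv (Matrix.toBilin' (k3HilbertGram n)),
        g.discriminantGroupCongr = LinearEquiv.refl ℤ _ ∧ g r.1 = s.1) = 1 := by
  obtain ⟨ψ, -⟩ := exists_isometryEquiv_toBilin'_k3HilbertGram_prod (n := n) (by omega)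
  obtain ⟨x, y, x₁, y₁, hP⟩ := exists_twoHyperbolicPairs_toBilin'_k3Gram
  rw [natCard_quot_stable_isometryEquiv_eq_of_isometryEquiv ψ _
    (fun r ↦ (Matrix.toBilin' k3Gram).prod ((-(2 * (n - 1 : ℕ) : ℤ)) • LinearMap.mul ℤ ℤ) r r = 2 * d ∧
      ∃ r', (Matrix.toBilin' k3Gram).prod ((-(2 * (n - 1 : ℕ) : ℤ)) • LinearMap.mul ℤ ℤ) r r' = 1)
    (fun r ↦ by rw [ψ.map_app, exists_apply_eq_iff_of_isometryEquiv ψ r 1])]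
  exact natCard_quot_stable_isometryEquiv_two_mul_of_apply_eq_one (n - 1) isUnimodular_toBilin'_k3Gram
    isEven_toBilin'_k3Gram (by omega) hP d

/-- **Example 4.8 in `Λ_n`, the complement: `h^⊥ ≅ L_{2t,2d} = 2U ⊕ 2E₈(−1) ⊕ ⟨−2t⟩ ⊕ ⟨−2d⟩`** for every split `h ∈ Λ_n`
(`h² = 2d`, `(h, h') = 1`; bracketed `((2E₈(−1) ⊕ 2U) ⊕ ⟨−2d⟩) ⊕ ⟨−2(n−1)⟩`). [cite: GritsenkoHulekSankaran2010Symplectic, §4 Example 4.8] -/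
theorem k3Hilbert_restrict_orthogonal_equivalent_of_apply_eq_one (hn : 2 ≤ n) {h h' : K3HilbertIndex → ℤ} {d : ℤ}
    (hh : Matrix.toBilin' (k3HilbertGram n) h h = 2 * d) (hh' : Matrix.toBilin' (k3HilbertGram n) h h' = 1) :
    ((Matrix.toBilin' (k3HilbertGram n)).restrict ((Matrix.toBilin' (k3HilbertGram n)).orthogonal (ℤ ∙ h))).Equivalent
      ((((LinearMap.BilinForm.pi fun _ : Fin 2 ↦ -e8Form).prod (hyperbolicSum 2)).prod ((-(2 * d)) • LinearMap.mul ℤ ℤ)).prod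
        ((-(2 * (n - 1 : ℕ) : ℤ)) • LinearMap.mul ℤ ℤ)) := by
  obtain ⟨φ⟩ := toBilin'_k3HilbertGram_equivalent_model (n := n) (by omega)
  exact (restrict_orthogonal_equivalent_of_isometryEquiv φ h).trans
    (restrict_orthogonal_model_equivalent_of_apply_eq_one 2 1 (n - 1) (by omega) (r := φ h) (r' := φ h')
      (by rw [φ.map_app, hh]) (by rw [φ.map_app, hh']))

/-- **Example 4.10 in `Λ_n`, necessity: a primitive `h ∈ Λ_n` with `h² = 2d` and `(h, Λ_n) ⊆ 2ℤ` has odd `δ`-coordinate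
(`h = 2v + c δ`, "`c` is odd") and `d + (n − 1) ≡ 0 (mod 4)`.** [cite: GritsenkoHulekSankaran2010Symplectic, §4 Example 4.10 ("a constant `b` and a vector `h_d` exist if and only if `d + t ≡ 0 mod 4`")] -/
theorem k3Hilbert_odd_and_four_dvd_add_of_forall_two_dvd (hn : 2 ≤ n) {h : K3HilbertIndex → ℤ} {d : ℤ}
    (hh : Matrix.toBilin' (k3HilbertGram n) h h = 2 * d) (hh0 : h ≠ 0)
    (hsat : ∀ (k : ℤ) (w : K3HilbertIndex → ℤ), k ≠ 0 → k • w ∈ ℤ ∙ h → w ∈ ℤ ∙ h)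
    (h2 : ∀ z, (2 : ℤ) ∣ Matrix.toBilin' (k3HilbertGram n) h z) : Odd (h (Sum.inr ())) ∧ (4 : ℤ) ∣ d + (n - 1 : ℕ) := by
  obtain ⟨ψ, hψ⟩ := exists_isometryEquiv_toBilin'_k3HilbertGram_prod (n := n) (by omega)
  have h0 : ψ h ≠ 0 := fun h1 ↦ hh0 (ψ.toLinearEquiv.map_eq_zero_iff.1 h1)
  have h1 := odd_snd_and_four_dvd_add_of_forall_two_dvd (n - 1) isUnimodular_toBilin'_k3Gram isEven_toBilin'_k3Gram
    (r := ψ h) (d := d) (by rw [ψ.map_app, hh]) h0 (forall_mem_span_singleton_apply_of_isometryEquiv ψ hsat)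
    ((forall_dvd_apply_iff_of_isometryEquiv ψ h 2).2 h2)
  rwa [hψ] at h1

/-- **Example 4.10 in `Λ_n`, existence: if `d + (n − 1) = 4b` then `h = 2(e + bf) + δ` is a primitive vector of `Λ_n` with
`h² = 2d`, `(h, f) = 2`, all products even and `δ`-coordinate `1`** ("we may take `c = 1`").
[cite: GritsenkoHulekSankaran2010Symplectic, §4 Example 4.10] -/
theorem k3Hilbert_exists_apply_self_eq_two_mul_and_forall_two_dvd_of_four_dvd (hn : 2 ≤ n) {d b : ℤ}
    (hb : d + (n - 1 : ℕ) = 4 * b) :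
    ∃ h h' : K3HilbertIndex → ℤ, h (Sum.inr ()) = 1 ∧ Matrix.toBilin' (k3HilbertGram n) h h = 2 * d ∧
      Matrix.toBilin' (k3HilbertGram n) h h' = 2 ∧ (∀ z, (2 : ℤ) ∣ Matrix.toBilin' (k3HilbertGram n) h z) ∧
        ∀ (k : ℤ) (w : K3HilbertIndex → ℤ), k ≠ 0 → k • w ∈ ℤ ∙ h → w ∈ ℤ ∙ h := by
  obtain ⟨ψ, hψ⟩ := exists_isometryEquiv_toBilin'_k3HilbertGram_prod (n := n) (by omega)
  obtain ⟨x, y, x₁, y₁, hP⟩ := exists_twoHyperbolicPairs_toBilin'_k3Gram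
  obtain ⟨r, r', hr1, hr, hr', h2r, hrsat⟩ :=
    exists_apply_self_eq_two_mul_and_forall_two_dvd_of_four_dvd (n - 1) hP (d := d) (b := b) hb
  have hψr : ψ (ψ.symm r) = r := ψ.toLinearEquiv.apply_symm_apply r
  refine ⟨ψ.symm r, ψ.symm r', ?_, by rw [ψ.symm.map_app, hr], by rw [ψ.symm.map_app, hr'],
    (forall_dvd_apply_iff_of_isometryEquiv ψ.symm r 2).2 h2r, forall_mem_span_singleton_apply_of_isometryEquiv ψ.symm hrsat⟩
  have h3 := congrArg Prod.snd (hψ (ψ.symm r))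
  rw [hψr] at h3
  rw [← hr1, h3]

/-- **Example 4.10 in `Λ_n`, the orbit: "the `Õ(L_{2t})`-orbit of `h_d` is unique because `D(L_{2t})` is cyclic"** — two
primitive vectors of `Λ_n` of the same square `2d` with `(h, Λ_n) = 2ℤ` lie in one `Õ(Λ_n)`-orbit.
[cite: GritsenkoHulekSankaran2010Symplectic, §4 Example 4.10] -/
theorem k3Hilbert_exists_stable_isometryEquiv_apply_eq_of_forall_two_dvd_of_primitive (hn : 2 ≤ n)
    {u v u' v' : K3HilbertIndex → ℤ} {d : ℤ} (huu : Matrix.toBilin' (k3HilbertGram n) u u = 2 * d)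
    (hvv : Matrix.toBilin' (k3HilbertGram n) v v = 2 * d) (hu0 : u ≠ 0)
    (husat : ∀ (k : ℤ) (w : K3HilbertIndex → ℤ), k ≠ 0 → k • w ∈ ℤ ∙ u → w ∈ ℤ ∙ u) (hv0 : v ≠ 0)
    (hvsat : ∀ (k : ℤ) (w : K3HilbertIndex → ℤ), k ≠ 0 → k • w ∈ ℤ ∙ v → w ∈ ℤ ∙ v)
    (h2u : ∀ z, (2 : ℤ) ∣ Matrix.toBilin' (k3HilbertGram n) u z) (h2v : ∀ z, (2 : ℤ) ∣ Matrix.toBilin' (k3HilbertGram n) v z)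
    (hu' : Matrix.toBilin' (k3HilbertGram n) u u' = 2) (hv' : Matrix.toBilin' (k3HilbertGram n) v v' = 2) :
    ∃ g : (Matrix.toBilin' (k3HilbertGram n)).IsometryEquiv (Matrix.toBilin' (k3HilbertGram n)),
      g.discriminantGroupCongr = LinearEquiv.refl ℤ _ ∧ g u = v := by
  obtain ⟨ψ, -⟩ := exists_isometryEquiv_toBilin'_k3HilbertGram_prod (n := n) (by omega)
  obtain ⟨x, y, x₁, y₁, hP⟩ := exists_twoHyperbolicPairs_toBilin'_k3Gram
  have hu0' : ψ u ≠ 0 := fun h1 ↦ hu0 (ψ.toLinearEquiv.map_eq_zero_iff.1 h1)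
  have hv0' : ψ v ≠ 0 := fun h1 ↦ hv0 (ψ.toLinearEquiv.map_eq_zero_iff.1 h1)
  obtain ⟨g₀, hg₀, hg₀u⟩ := exists_stable_isometryEquiv_apply_eq_of_forall_two_dvd_of_primitive (n - 1)
    isUnimodular_toBilin'_k3Gram isEven_toBilin'_k3Gram (by omega) hP (u := ψ u) (v := ψ v) (u' := ψ u') (v' := ψ v')
    (d := d) (by rw [ψ.map_app, huu]) (by rw [ψ.map_app, hvv]) hu0' (forall_mem_span_singleton_apply_of_isometryEquiv ψ husat)
    hv0' (forall_mem_span_singleton_apply_of_isometryEquiv ψ hvsat) ((forall_dvd_apply_iff_of_isometryEquiv ψ u 2).2 h2u)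
    ((forall_dvd_apply_iff_of_isometryEquiv ψ v 2).2 h2v) (by rw [ψ.map_app, hu']) (by rw [ψ.map_app, hv'])
  refine ⟨ψ.trans (g₀.trans ψ.symm), discriminantGroupCongr_trans_trans_symm_eq_refl ψ hg₀, ?_⟩
  rw [LinearMap.BilinForm.IsometryEquiv.trans_apply, LinearMap.BilinForm.IsometryEquiv.trans_apply, hg₀u]
  exact ψ.toLinearEquiv.symm_apply_apply v

/-- **Example 4.10 in `Λ_n` as a count: the primitive vectors of square `2d` with `(h, Λ_n) = 2ℤ` form ONE `Õ(Λ_n)`-orbit if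
`d + (n − 1) ≡ 0 (mod 4)` and do not exist otherwise.** [cite: GritsenkoHulekSankaran2010Symplectic, §4 Example 4.10] -/
theorem k3Hilbert_natCard_quot_stable_isometryEquiv_of_forall_two_dvd_of_primitive (hn : 2 ≤ n) (d : ℤ) :
    Nat.card (Quot fun r s : {r : K3HilbertIndex → ℤ // Matrix.toBilin' (k3HilbertGram n) r r = 2 * d ∧ r ≠ 0 ∧
        (∀ (k : ℤ) (w : K3HilbertIndex → ℤ), k ≠ 0 → k • w ∈ ℤ ∙ r → w ∈ ℤ ∙ r) ∧
        (∀ z, (2 : ℤ) ∣ Matrix.toBilin' (k3HilbertGram n) r z) ∧ ∃ r', Matrix.toBilin' (k3HilbertGram n) r r' = 2} ↦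
      ∃ g : (Matrix.toBilin' (k3HilbertGram n)).IsometryEquiv (Matrix.toBilin' (k3HilbertGram n)),
        g.discriminantGroupCongr = LinearEquiv.refl ℤ _ ∧ g r.1 = s.1) = if (4 : ℤ) ∣ d + (n - 1 : ℕ) then 1 else 0 := by
  obtain ⟨ψ, -⟩ := exists_isometryEquiv_toBilin'_k3HilbertGram_prod (n := n) (by omega)
  obtain ⟨x, y, x₁, y₁, hP⟩ := exists_twoHyperbolicPairs_toBilin'_k3Gram
  rw [natCard_quot_stable_isometryEquiv_eq_of_isometryEquiv ψ _
    (fun r ↦ (Matrix.toBilin' k3Gram).prod ((-(2 * (n - 1 : ℕ) : ℤ)) • LinearMap.mul ℤ ℤ) r r = 2 * d ∧ r ≠ 0 ∧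
      (∀ (k : ℤ) (w : (K3Index → ℤ) × ℤ), k ≠ 0 → k • w ∈ ℤ ∙ r → w ∈ ℤ ∙ r) ∧
      (∀ z, (2 : ℤ) ∣ (Matrix.toBilin' k3Gram).prod ((-(2 * (n - 1 : ℕ) : ℤ)) • LinearMap.mul ℤ ℤ) r z) ∧
      ∃ r', (Matrix.toBilin' k3Gram).prod ((-(2 * (n - 1 : ℕ) : ℤ)) • LinearMap.mul ℤ ℤ) r r' = 2)
    (fun r ↦ ?_)]
  · exact natCard_quot_stable_isometryEquiv_two_mul_of_forall_two_dvd_of_primitive (n - 1) isUnimodular_toBilin'_k3Gram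
      isEven_toBilin'_k3Gram (by omega) hP d
  · have hr0 : r ≠ 0 ↔ ψ r ≠ 0 := ψ.toLinearEquiv.map_ne_zero_iff.symm
    have hsat : (∀ (k : ℤ) (w : K3HilbertIndex → ℤ), k ≠ 0 → k • w ∈ ℤ ∙ r → w ∈ ℤ ∙ r) ↔
        ∀ (k : ℤ) (w : (K3Index → ℤ) × ℤ), k ≠ 0 → k • w ∈ ℤ ∙ ψ r → w ∈ ℤ ∙ ψ r := by
      refine ⟨forall_mem_span_singleton_apply_of_isometryEquiv ψ, fun hs ↦ ?_⟩
      have h1 := forall_mem_span_singleton_apply_of_isometryEquiv ψ.symm hs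
      rwa [show ψ.symm (ψ r) = r from ψ.toLinearEquiv.symm_apply_apply r] at h1
    rw [ψ.map_app, hr0, hsat, forall_dvd_apply_iff_of_isometryEquiv ψ r 2, exists_apply_eq_iff_of_isometryEquiv ψ r 2]

/-- **Example 4.10 in `Λ_n`, the complement: `h^⊥ ≅ 2U ⊕ 2E₈(−1) ⊕ (−2b t ∕ t −2t)`, `4b = d + t`, `t = n − 1`**, for every
primitive `h ∈ Λ_n` with `h² = 2d` and `(h, Λ_n) = 2ℤ` (bracketed `(2E₈(−1) ⊕ 2U) ⊕ B`). For `n = 2` (`K3^{[2]}`) this is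
`L_{Q(d)}`, `Q(d) ≅ (−2 1 ∕ 1 −(d+1)/2)` (GHS Handbook Example 7.7). [cite: GritsenkoHulekSankaran2010Symplectic, §4 Example 4.10 and Prop. 4.6 (iv)] -/
theorem k3Hilbert_restrict_orthogonal_equivalent_of_forall_two_dvd_of_primitive (hn : 2 ≤ n) {h : K3HilbertIndex → ℤ}
    {d b : ℤ} (hb : d + (n - 1 : ℕ) = 4 * b) (hh : Matrix.toBilin' (k3HilbertGram n) h h = 2 * d) (hh0 : h ≠ 0)
    (hsat : ∀ (k : ℤ) (w : K3HilbertIndex → ℤ), k ≠ 0 → k • w ∈ ℤ ∙ h → w ∈ ℤ ∙ h)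
    (h2 : ∀ z, (2 : ℤ) ∣ Matrix.toBilin' (k3HilbertGram n) h z) (hh' : ∃ h', Matrix.toBilin' (k3HilbertGram n) h h' = 2) :
    ((Matrix.toBilin' (k3HilbertGram n)).restrict ((Matrix.toBilin' (k3HilbertGram n)).orthogonal (ℤ ∙ h))).Equivalent
      (((LinearMap.BilinForm.pi fun _ : Fin 2 ↦ -e8Form).prod (hyperbolicSum 2)).prod
        (Matrix.toBilin' !![-(2 * b), ((n - 1 : ℕ) : ℤ); ((n - 1 : ℕ) : ℤ), -(2 * (n - 1 : ℕ) : ℤ)])) := by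
  obtain ⟨φ⟩ := toBilin'_k3HilbertGram_equivalent_model (n := n) (by omega)
  have h0 : φ h ≠ 0 := fun h1 ↦ hh0 (φ.toLinearEquiv.map_eq_zero_iff.1 h1)
  exact (restrict_orthogonal_equivalent_of_isometryEquiv φ h).trans
    (restrict_orthogonal_model_equivalent_of_forall_two_dvd_of_primitive 2 1 (n - 1) (by omega) hb (r := φ h)
      (by rw [φ.map_app, hh]) h0 (forall_mem_span_singleton_apply_of_isometryEquiv φ hsat)
      ((forall_dvd_apply_iff_of_isometryEquiv φ h 2).2 h2) ((exists_apply_eq_iff_of_isometryEquiv φ h 2).2 hh'))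

/-- **`|O(q_{Λ_n})| = 2^{ρ(n−1)}`** (`n ≥ 2`; `ρ` = number of prime divisors): `(D(Λ_n), q) ≅ (D(⟨−2(n−1)⟩), q)` as `Λ_{K3}`
is unimodular, and GHS 2007 Lemma 4.3. This is the order `2^{ρ(t)}` in Prop. 4.12 (ii) for `L_{2t}`, `t = n − 1`.
[cite: GritsenkoHulekSankaran2007HM, §4 Lemma 4.3] [cite: GritsenkoHulekSankaran2010Symplectic, §4 Prop. 4.12 (ii)] -/
theorem natCard_discriminantIsometry_toBilin'_k3HilbertGram (hn : 2 ≤ n)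
    (h₁ : (Matrix.toBilin' (k3HilbertGram n)).Nondegenerate) (h₂ : (Matrix.toBilin' (k3HilbertGram n)).IsSymm)
    (h₃ : (Matrix.toBilin' (k3HilbertGram n)).IsEven) :
    Nat.card {σ : (Matrix.toBilin' (k3HilbertGram n)).discriminantGroup ≃ₗ[ℤ]
        (Matrix.toBilin' (k3HilbertGram n)).discriminantGroup //
        ∀ a, (Matrix.toBilin' (k3HilbertGram n)).discriminantQuad h₁ h₂ h₃ (σ a) =
          (Matrix.toBilin' (k3HilbertGram n)).discriminantQuad h₁ h₂ h₃ a} = 2 ^ (n - 1).primeFactors.card := by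
  obtain ⟨ψ, -⟩ := exists_isometryEquiv_toBilin'_k3HilbertGram_prod (n := n) (by omega)
  obtain ⟨hR, hsR, heR⟩ := nondegenerate_isSymm_isEven_neg_twoMul_smul_mul (n - 1) (by omega)
  have h₁' : ((Matrix.toBilin' k3Gram).prod ((-(2 * (n - 1 : ℕ) : ℤ)) • LinearMap.mul ℤ ℤ)).Nondegenerate :=
    isUnimodular_toBilin'_k3Gram.nondegenerate.prod hR
  have h₂' : ((Matrix.toBilin' k3Gram).prod ((-(2 * (n - 1 : ℕ) : ℤ)) • LinearMap.mul ℤ ℤ)).IsSymm :=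
    isSymm_toBilin'_k3Gram.prod hsR
  have h₃' : ((Matrix.toBilin' k3Gram).prod ((-(2 * (n - 1 : ℕ) : ℤ)) • LinearMap.mul ℤ ℤ)).IsEven :=
    isEven_prod_iff.2 ⟨isEven_toBilin'_k3Gram, heR⟩
  rw [natCard_discriminantIsometry_eq_of_isometryEquiv _ _ ψ h₁ h₂ h₃ h₁' h₂' h₃']
  exact natCard_discriminantIsometry_prod_neg_twoMul_smul_mul_of_isUnimodular _ isSymm_toBilin'_k3Gram
    isUnimodular_toBilin'_k3Gram isEven_toBilin'_k3Gram (by omega) h₁' h₂' h₃'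

/-- **Prop. 4.12 (ii) for `f = 1` in `Λ_n`: `|O(Λ_n, h)/Õ(Λ_n, h)| = 2^{ρ(n−1)}` for EVERY split `h`** (`h² = 2d ≠ 0`,
`(h, h') = 1`): the restrictions to `h^⊥` of the isometries of `Λ_n` fixing `h`, modulo those inducing the same automorphism
of `D(h^⊥)` (i.e. modulo `Õ(h^⊥) ≅ Õ(Λ_n, h)`, Prop. 4.12 (i)), number `2^{ρ(t)}`, `t = n − 1` ("The factor group
`O(L_{2t}, h_d)/Õ(L_{2t}, h_d)` is an abelian `2`-group, which is of order `2^{ρ(t/f)}` if `f` is odd"; no group structure is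
declared here, so "abelian `2`-group" is not stated). [cite: GritsenkoHulekSankaran2010Symplectic, §4 Prop. 4.12 (ii), Example 4.8] [cite: GritsenkoHulekSankaran2007HM, §4 Lemma 4.3] -/
theorem k3Hilbert_natCard_quot_exists_isometryEquiv_apply_eq_of_apply_eq_one (hn : 2 ≤ n) {d : ℤ} (hd : d ≠ 0)
    {u u' : K3HilbertIndex → ℤ} (hu : Matrix.toBilin' (k3HilbertGram n) u u = 2 * d)
    (hu' : Matrix.toBilin' (k3HilbertGram n) u u' = 1) :
    Nat.card (Quot fun γ γ' : {γ : ((Matrix.toBilin' (k3HilbertGram n)).restrict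
          ((Matrix.toBilin' (k3HilbertGram n)).orthogonal (ℤ ∙ u))).IsometryEquiv
          ((Matrix.toBilin' (k3HilbertGram n)).restrict ((Matrix.toBilin' (k3HilbertGram n)).orthogonal (ℤ ∙ u))) //
        ∃ G : (Matrix.toBilin' (k3HilbertGram n)).IsometryEquiv (Matrix.toBilin' (k3HilbertGram n)),
          G u = u ∧ ∀ m : (Matrix.toBilin' (k3HilbertGram n)).orthogonal (ℤ ∙ u), G m = γ m} ↦
        γ.1.discriminantGroupCongr = γ'.1.discriminantGroupCongr) = 2 ^ (n - 1).primeFactors.card := by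
  obtain ⟨φ⟩ := toBilin'_k3HilbertGram_equivalent_model (n := n) (by omega)
  obtain ⟨hs, he, huB⟩ := isSymm_isEven_isUnimodular_pi_neg_e8Form_prod_hyperbolicSum' 2 3
  obtain ⟨-, hsR, heR⟩ := nondegenerate_isSymm_isEven_neg_twoMul_smul_mul (n - 1) (by omega)
  rw [natCard_quot_exists_isometryEquiv_apply_eq_eq_of_isometryEquiv φ u]
  exact natCard_quot_exists_isometryEquiv_apply_eq_model_of_apply_eq_one 2 1 (t := n - 1) (by omega) hd
    (nondegenerate_prod_neg_twoMul_smul_mul _ (n - 1) huB (by omega)) (hs.prod hsR) (isEven_prod_iff.2 ⟨he, heR⟩)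
    (u := φ u) (u' := φ u') (by rw [φ.map_app, hu]) (by rw [φ.map_app, hu'])

end PolarisationTypes

/-! ### §4 Prop. 4.6 for a general divisor `f` in `Λ_n` (row g43-#4) -/

section GeneralDivisor

variable {n : ℕ}

/-- **"The coefficient `c` is coprime to `f` because `h_d` is primitive"** in `Λ_n`: for a primitive `h ∈ Λ_n` (`n ≥ 1`)
with `f ∣ (h, z)` for all `z`, the `δ`-coordinate `h_δ` is coprime to `f` (`h = fv + h_δ δ`).
[cite: GritsenkoHulekSankaran2010Symplectic, §4 proof of Prop. 4.6] -/
theorem k3Hilbert_gcd_eq_one_of_primitive_of_forall_dvd (hn : 1 ≤ n) {h : K3HilbertIndex → ℤ} {f : ℤ} (hh0 : h ≠ 0)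
    (hsat : ∀ (k : ℤ) (w : K3HilbertIndex → ℤ), k ≠ 0 → k • w ∈ ℤ ∙ h → w ∈ ℤ ∙ h)
    (hf : ∀ z, f ∣ Matrix.toBilin' (k3HilbertGram n) h z) : Int.gcd f (h (Sum.inr ())) = 1 := by
  obtain ⟨ψ, hψ⟩ := exists_isometryEquiv_toBilin'_k3HilbertGram_prod hn
  have h0 : ψ h ≠ 0 := fun h1 ↦ hh0 (ψ.toLinearEquiv.map_eq_zero_iff.1 h1)
  have h1 := gcd_snd_eq_one_of_primitive_of_forall_dvd (n - 1) isUnimodular_toBilin'_k3Gram h0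
    (forall_mem_span_singleton_apply_of_isometryEquiv ψ hsat) ((forall_dvd_apply_iff_of_isometryEquiv ψ h f).2 hf)
  rwa [hψ] at h1

/-- **"`2d = 2bf² − 2c²t`" in `Λ_n`: `f² ∣ d + (n−1)h_δ²`** for `h ∈ Λ_n` with `h² = 2d` and `f ∣ (h, z)` for all `z`.
[cite: GritsenkoHulekSankaran2010Symplectic, §4 proof of Prop. 4.6 (display (c-eq))] -/
theorem k3Hilbert_sq_dvd_add_mul_sq_of_forall_dvd (hn : 1 ≤ n) {h : K3HilbertIndex → ℤ} {f d : ℤ}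
    (hh : Matrix.toBilin' (k3HilbertGram n) h h = 2 * d) (hf : ∀ z, f ∣ Matrix.toBilin' (k3HilbertGram n) h z) :
    f ^ 2 ∣ d + (n - 1 : ℕ) * h (Sum.inr ()) ^ 2 := by
  obtain ⟨ψ, hψ⟩ := exists_isometryEquiv_toBilin'_k3HilbertGram_prod hn
  have h1 := sq_dvd_add_mul_snd_sq_of_forall_dvd (n - 1) isUnimodular_toBilin'_k3Gram isEven_toBilin'_k3Gram (r := ψ h)
    (by rw [ψ.map_app, hh]) ((forall_dvd_apply_iff_of_isometryEquiv ψ h f).2 hf)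
  rwa [hψ] at h1

/-- **Prop. 4.6, the count, in `Λ_n`**: for `n ≥ 2`, `f ≥ 1`, `f ∣ 2(n−1)`, the `Õ(Λ_n)`-orbits of primitive `h ∈ Λ_n` with
`h² = 2d` and `(h, Λ_n) = fℤ` are in bijection (via `h_δ mod f`) with `{c mod f : (c, f) = 1, f² ∣ d + (n−1)c²}` ("the
`Õ(L_{2t})`-orbit of `h_d` is … determined by `c mod f`"; their number is evaluated in Prop. 4.6 (i)–(iii)).
[cite: GritsenkoHulekSankaran2010Symplectic, §4 Prop. 4.6 and proof, first paragraph] -/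
theorem k3Hilbert_natCard_quot_stable_isometryEquiv_of_divisor (hn : 2 ≤ n) (d : ℤ) {f : ℕ} (hf0 : 0 < f)
    (hf : (f : ℤ) ∣ 2 * (n - 1 : ℕ)) :
    Nat.card (Quot fun r s : {r : K3HilbertIndex → ℤ // Matrix.toBilin' (k3HilbertGram n) r r = 2 * d ∧ r ≠ 0 ∧
        (∀ (k : ℤ) (w : K3HilbertIndex → ℤ), k ≠ 0 → k • w ∈ ℤ ∙ r → w ∈ ℤ ∙ r) ∧
        (∀ z, (f : ℤ) ∣ Matrix.toBilin' (k3HilbertGram n) r z) ∧ ∃ r', Matrix.toBilin' (k3HilbertGram n) r r' = f} ↦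
      ∃ g : (Matrix.toBilin' (k3HilbertGram n)).IsometryEquiv (Matrix.toBilin' (k3HilbertGram n)),
        g.discriminantGroupCongr = LinearEquiv.refl ℤ _ ∧ g r.1 = s.1) =
      Nat.card {c : ZMod f // IsUnit c ∧ (f : ℤ) ^ 2 ∣ d + (n - 1 : ℕ) * (c.val : ℤ) ^ 2} := by
  obtain ⟨ψ, -⟩ := exists_isometryEquiv_toBilin'_k3HilbertGram_prod (n := n) (by omega)
  obtain ⟨x, y, x₁, y₁, hP⟩ := exists_twoHyperbolicPairs_toBilin'_k3Gram
  rw [natCard_quot_stable_isometryEquiv_eq_of_isometryEquiv ψ _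
    (fun r ↦ (Matrix.toBilin' k3Gram).prod ((-(2 * (n - 1 : ℕ) : ℤ)) • LinearMap.mul ℤ ℤ) r r = 2 * d ∧ r ≠ 0 ∧
      (∀ (k : ℤ) (w : (K3Index → ℤ) × ℤ), k ≠ 0 → k • w ∈ ℤ ∙ r → w ∈ ℤ ∙ r) ∧
      (∀ z, (f : ℤ) ∣ (Matrix.toBilin' k3Gram).prod ((-(2 * (n - 1 : ℕ) : ℤ)) • LinearMap.mul ℤ ℤ) r z) ∧
      ∃ r', (Matrix.toBilin' k3Gram).prod ((-(2 * (n - 1 : ℕ) : ℤ)) • LinearMap.mul ℤ ℤ) r r' = f)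
    (fun r ↦ ?_)]
  · exact natCard_quot_stable_isometryEquiv_two_mul_of_divisor (n - 1) isUnimodular_toBilin'_k3Gram
      isEven_toBilin'_k3Gram (by omega) hP d hf0 hf
  · have hr0 : r ≠ 0 ↔ ψ r ≠ 0 := ψ.toLinearEquiv.map_ne_zero_iff.symm
    have hsat : (∀ (k : ℤ) (w : K3HilbertIndex → ℤ), k ≠ 0 → k • w ∈ ℤ ∙ r → w ∈ ℤ ∙ r) ↔
        ∀ (k : ℤ) (w : (K3Index → ℤ) × ℤ), k ≠ 0 → k • w ∈ ℤ ∙ ψ r → w ∈ ℤ ∙ ψ r := by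
      refine ⟨forall_mem_span_singleton_apply_of_isometryEquiv ψ, fun hs ↦ ?_⟩
      have h1 := forall_mem_span_singleton_apply_of_isometryEquiv ψ.symm hs
      rwa [show ψ.symm (ψ r) = r from ψ.toLinearEquiv.symm_apply_apply r] at h1
    rw [ψ.map_app, hr0, hsat, forall_dvd_apply_iff_of_isometryEquiv ψ r f, exists_apply_eq_iff_of_isometryEquiv ψ r f]

/-- **Prop. 4.6 (iv) in `Λ_n`: `h^⊥ ≅ 2U ⊕ 2E₈(−1) ⊕ B`, `B = (−2b a ∕ a −2(n−1))`** for EVERY primitive `h ∈ Λ_n` (`n ≥ 2`) with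
`h² = 2d`, `(h, Λ_n) = fℤ` (`f ≠ 0`), where `c = h_δ`, `f²b = d + (n−1)c²` and `fa = 2(n−1)c` (`a = c·2t/f`, `t = n − 1`;
bracketed `(2E₈(−1) ⊕ 2U) ⊕ B`). [cite: GritsenkoHulekSankaran2010Symplectic, §4 Prop. 4.6 (iv)] -/
theorem k3Hilbert_restrict_orthogonal_equivalent_of_divisor (hn : 2 ≤ n) {h : K3HilbertIndex → ℤ} {f d b a : ℤ}
    (hf : f ≠ 0) (hh : Matrix.toBilin' (k3HilbertGram n) h h = 2 * d)
    (hfh : ∀ z, f ∣ Matrix.toBilin' (k3HilbertGram n) h z) (hh' : ∃ h', Matrix.toBilin' (k3HilbertGram n) h h' = f)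
    (hb : f ^ 2 * b = d + (n - 1 : ℕ) * h (Sum.inr ()) ^ 2) (ha : f * a = 2 * (n - 1 : ℕ) * h (Sum.inr ())) :
    ((Matrix.toBilin' (k3HilbertGram n)).restrict ((Matrix.toBilin' (k3HilbertGram n)).orthogonal (ℤ ∙ h))).Equivalent
      (((LinearMap.BilinForm.pi fun _ : Fin 2 ↦ -e8Form).prod (hyperbolicSum 2)).prod
        (Matrix.toBilin' !![-(2 * b), a; a, -(2 * (n - 1 : ℕ) : ℤ)])) := by
  obtain ⟨ψ, hψ⟩ := exists_isometryEquiv_toBilin'_k3HilbertGram_prod (n := n) (by omega)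
  obtain ⟨e⟩ := toBilin'_k3Gram_equivalent_pi_neg_e8Form_prod_hyperbolicSum
  let φ := ψ.trans (e.prodCongr (LinearMap.BilinForm.IsometryEquiv.refl ((-(2 * (n - 1 : ℕ) : ℤ)) • LinearMap.mul ℤ ℤ)))
  have hφ2 : (φ h).2 = h (Sum.inr ()) := by
    change ((e.prodCongr (LinearMap.BilinForm.IsometryEquiv.refl _)) (ψ h)).2 = _
    rw [LinearMap.BilinForm.IsometryEquiv.prodCongr_apply, hψ]
    rfl
  rw [← hφ2] at hb ha
  exact (restrict_orthogonal_equivalent_of_isometryEquiv φ h).trans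
    (restrict_orthogonal_model_equivalent_of_divisor 2 1 (n - 1) (by omega) hf (r := φ h) (by rw [φ.map_app, hh])
      ((forall_dvd_apply_iff_of_isometryEquiv φ h f).2 hfh) ((exists_apply_eq_iff_of_isometryEquiv φ h f).2 hh') hb ha)

end GeneralDivisor

/-! ### §5 `K3^{[2]}`-type (`n = 2`, `t = 1`): split, or non-split with `d ≡ −1 (mod 4)` (row g43-#4) -/

section HilbertSquare

/-- **`K3^{[2]}`: every primitive `h ∈ Λ_2 = Λ_{K3} ⊕ ⟨−2⟩` of square `2d` is split (`(h, h') = 1`) or non-split with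
`(h, Λ_2) = 2ℤ`, odd `δ`-coordinate and `d ≡ −1 (mod 4)`** (Examples 4.10/4.11 for `t = 1`: "if `(t, d) = 1` then
`f = div(h_d)` is equal to `1` or `2`", "`d + t ≡ 0 mod 4`"; "in particular if `t = 1` or `d = 1`").
[cite: GritsenkoHulekSankaran2010Symplectic, §4 Examples 4.10, 4.11] -/
theorem k3HilbertTwo_split_or_nonsplit {h : K3HilbertIndex → ℤ} {d : ℤ}
    (hh : Matrix.toBilin' (k3HilbertGram 2) h h = 2 * d) (hh0 : h ≠ 0)
    (hsat : ∀ (k : ℤ) (w : K3HilbertIndex → ℤ), k ≠ 0 → k • w ∈ ℤ ∙ h → w ∈ ℤ ∙ h) :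
    (∃ h', Matrix.toBilin' (k3HilbertGram 2) h h' = 1) ∨
      ((∀ z, (2 : ℤ) ∣ Matrix.toBilin' (k3HilbertGram 2) h z) ∧ (∃ h', Matrix.toBilin' (k3HilbertGram 2) h h' = 2) ∧
        Odd (h (Sum.inr ())) ∧ (4 : ℤ) ∣ d + 1) := by
  rcases k3Hilbert_exists_apply_eq_one_or_forall_two_dvd_of_gcd_eq_one (n := 2) le_rfl hh hh0 hsat (by simp) with h1 | ⟨h2, h2'⟩
  · exact Or.inl h1
  · obtain ⟨ho, h4⟩ := k3Hilbert_odd_and_four_dvd_add_of_forall_two_dvd (n := 2) le_rfl hh hh0 hsat h2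
    exact Or.inr ⟨h2, h2', ho, by simpa using h4⟩

/-- **`K3^{[2]}`, split type: for every `d` the split vectors of square `2d` form exactly ONE `O(Λ_2)`-orbit** (`Õ(Λ_2) =
O(Λ_2)`, Example 4.8). [cite: GritsenkoHulekSankaran2010Symplectic, §4 Example 4.8 and §5 (display after "where `t = 1`")] -/
theorem k3HilbertTwo_natCard_quot_isometryEquiv_of_apply_eq_one (d : ℤ) :
    Nat.card (Quot fun r s : {r : K3HilbertIndex → ℤ // Matrix.toBilin' (k3HilbertGram 2) r r = 2 * d ∧
        ∃ r', Matrix.toBilin' (k3HilbertGram 2) r r' = 1} ↦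
      ∃ g : (Matrix.toBilin' (k3HilbertGram 2)).IsometryEquiv (Matrix.toBilin' (k3HilbertGram 2)), g r.1 = s.1) = 1 := by
  refine (Nat.card_congr (Quot.congr (Equiv.refl _) fun r s ↦ ?_)).trans
    (k3Hilbert_natCard_quot_stable_isometryEquiv_of_apply_eq_one (n := 2) le_rfl d)
  simp only [Equiv.refl_apply]
  exact ⟨fun ⟨g, hg⟩ ↦ ⟨g, LinearEquiv.ext (discriminantGroupCongr_eq_self_toBilin'_k3HilbertGram_two g), hg⟩,
    fun ⟨g, _, hg⟩ ↦ ⟨g, hg⟩⟩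

/-- **`K3^{[2]}`, non-split type: the primitive vectors of square `2d` with `(h, Λ_2) = 2ℤ` form ONE `O(Λ_2)`-orbit if
`d ≡ −1 (mod 4)` and do not exist otherwise** (Example 4.10 with `t = 1`; `Õ(Λ_2) = O(Λ_2)`).
[cite: GritsenkoHulekSankaran2010Symplectic, §4 Example 4.10 and §5 (display after "where `t = 1`")] -/
theorem k3HilbertTwo_natCard_quot_isometryEquiv_of_forall_two_dvd_of_primitive (d : ℤ) :
    Nat.card (Quot fun r s : {r : K3HilbertIndex → ℤ // Matrix.toBilin' (k3HilbertGram 2) r r = 2 * d ∧ r ≠ 0 ∧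
        (∀ (k : ℤ) (w : K3HilbertIndex → ℤ), k ≠ 0 → k • w ∈ ℤ ∙ r → w ∈ ℤ ∙ r) ∧
        (∀ z, (2 : ℤ) ∣ Matrix.toBilin' (k3HilbertGram 2) r z) ∧ ∃ r', Matrix.toBilin' (k3HilbertGram 2) r r' = 2} ↦
      ∃ g : (Matrix.toBilin' (k3HilbertGram 2)).IsometryEquiv (Matrix.toBilin' (k3HilbertGram 2)), g r.1 = s.1) =
      if (4 : ℤ) ∣ d + 1 then 1 else 0 := by
  have h1 := k3Hilbert_natCard_quot_stable_isometryEquiv_of_forall_two_dvd_of_primitive (n := 2) le_rfl d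
  simp only [show ((2 - 1 : ℕ) : ℤ) = 1 by norm_num] at h1
  refine (Nat.card_congr (Quot.congr (Equiv.refl _) fun r s ↦ ?_)).trans h1
  simp only [Equiv.refl_apply]
  exact ⟨fun ⟨g, hg⟩ ↦ ⟨g, LinearEquiv.ext (discriminantGroupCongr_eq_self_toBilin'_k3HilbertGram_two g), hg⟩,
    fun ⟨g, _, hg⟩ ↦ ⟨g, hg⟩⟩

/-- **`K3^{[2]}`, split complement: `h^⊥ ≅ (2E₈(−1) ⊕ 2U ⊕ ⟨−2d⟩) ⊕ ⟨−2⟩`** for every split `h ∈ Λ_2` of square `2d`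
(`L_{2,2d}` of GHS §5). [cite: GritsenkoHulekSankaran2010Symplectic, §4 Example 4.8 and §5 ("`L_{2,2d}`")] -/
theorem k3HilbertTwo_restrict_orthogonal_equivalent_of_apply_eq_one {h h' : K3HilbertIndex → ℤ} {d : ℤ}
    (hh : Matrix.toBilin' (k3HilbertGram 2) h h = 2 * d) (hh' : Matrix.toBilin' (k3HilbertGram 2) h h' = 1) :
    ((Matrix.toBilin' (k3HilbertGram 2)).restrict ((Matrix.toBilin' (k3HilbertGram 2)).orthogonal (ℤ ∙ h))).Equivalent
      ((((LinearMap.BilinForm.pi fun _ : Fin 2 ↦ -e8Form).prod (hyperbolicSum 2)).prod ((-(2 * d)) • LinearMap.mul ℤ ℤ)).prod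
        ((-2 : ℤ) • LinearMap.mul ℤ ℤ)) := by
  have h1 := k3Hilbert_restrict_orthogonal_equivalent_of_apply_eq_one (n := 2) le_rfl hh hh'
  simp only [show ((2 - 1 : ℕ) : ℤ) = 1 by norm_num, mul_one] at h1
  exact h1

/-- **`K3^{[2]}`, non-split complement: `h^⊥ ≅ 2U ⊕ 2E₈(−1) ⊕ (−2b 1 ∕ 1 −2)`, `4b = d + 1`**, for every primitive `h ∈ Λ_2`
of square `2d` with `(h, Λ_2) = 2ℤ` (GHS Handbook Example 7.7: `L_{Q(d)}`, `Q(d) ≅ (−2 1 ∕ 1 −(d+1)/2)`).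
[cite: GritsenkoHulekSankaran2010Symplectic, §4 Example 4.10 and Prop. 4.6 (iv)] -/
theorem k3HilbertTwo_restrict_orthogonal_equivalent_of_forall_two_dvd_of_primitive {h : K3HilbertIndex → ℤ} {d b : ℤ}
    (hb : d + 1 = 4 * b) (hh : Matrix.toBilin' (k3HilbertGram 2) h h = 2 * d) (hh0 : h ≠ 0)
    (hsat : ∀ (k : ℤ) (w : K3HilbertIndex → ℤ), k ≠ 0 → k • w ∈ ℤ ∙ h → w ∈ ℤ ∙ h)
    (h2 : ∀ z, (2 : ℤ) ∣ Matrix.toBilin' (k3HilbertGram 2) h z) (hh' : ∃ h', Matrix.toBilin' (k3HilbertGram 2) h h' = 2) :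
    ((Matrix.toBilin' (k3HilbertGram 2)).restrict ((Matrix.toBilin' (k3HilbertGram 2)).orthogonal (ℤ ∙ h))).Equivalent
      (((LinearMap.BilinForm.pi fun _ : Fin 2 ↦ -e8Form).prod (hyperbolicSum 2)).prod (Matrix.toBilin' !![-(2 * b), 1; 1, -2])) := by
  have h1 := k3Hilbert_restrict_orthogonal_equivalent_of_forall_two_dvd_of_primitive (n := 2) le_rfl (d := d) (b := b)
    (by simpa using hb) hh hh0 hsat h2 hh'
  simp only [show ((2 - 1 : ℕ) : ℤ) = 1 by norm_num, mul_one] at h1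
  exact h1

end HilbertSquare

end Literature.AlgebraicGeometry.Hyperkaehler
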